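import Summits.Parity.GeneralizedHardyLittlewood.Theorems.TypeI2Dilated.Negative.LogPowerBias
import Literature.NumberTheory.Sieve.FouvryTenenbaumLiouville

/-!
# `TypeI2Dilated` (stmt-Parity-14272): the fixed-dilation corner is settled (refuter, support)

Support file for the crux `Summit.Parity.GeneralizedHardyLittlewood.Theses.LiouvilleShiftedTables.TypeI2Dilated`
(X2 of route LiouvilleShiftedTables), continuing `Negative/LogPowerBias.lean`.

`slice_fixedQ_unit`: for every shift `-h`, FIXED dilation range `q ≤ Q₀` and `A > 0` there are
`C, x₀` with `∑_{q ≤ Q₀} |∑_{n ≤ y, n ≡ w (q)} λ(n - h)| ≤ C x/(log x)^A` for all `x ≥ x₀`, all `w`,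
all `0 ≤ y ≤ x` — the `R = S = 1`, `q ≤ Q₀` slice of the crux at the glue's sign `c = -h`,
UNCONDITIONALLY, from Siegel–Walfisz for `λ` (PROVED in tree:
`Literature.NumberTheory.LFunctions.SiegelWalfiszMoebius_holds.liouville_progression`) and the
monotonicity of `t/(log t)^A` (`div_log_rpow_mono`). Together with `Negative/LogPowerBias.lean`
(poly-log conductors are NECESSARY and settled) this locates the open content of X2 exactly in
the divisor variable `s`, the outer modulus `r ≤ x^ρ`, and the dilations `q > (log x)^B`.
Helpers: `sum_shift_neg` (the `Int.toNat`/`λ 0 = 0` corner of the crux made explicit),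
`filter_add_modEq_eq`.
-/

namespace Summit.Parity.GeneralizedHardyLittlewood.Cruxes.TypeI2Dilated.Negative

open Finset Real

/-- Shift by `-h`: the terms `n ≤ h` vanish (`λ 0 = 0` absorbs `Int.toNat` of non-positive
arguments) and `n ↦ m = n - h` re-indexes the rest. [folklore] -/
theorem sum_shift_neg (h N q w : ℕ) :
    ∑ n ∈ (Finset.Icc 1 N).filter (fun n : ℕ => n ≡ w [MOD q]),
        (ArithmeticFunction.liouville (Int.toNat ((n : ℤ) + (-(h : ℤ)))) : ℝ) =
      ∑ m ∈ (Finset.Icc 1 (N - h)).filter (fun m : ℕ => m + h ≡ w [MOD q]),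
        (ArithmeticFunction.liouville m : ℝ) := by
  rw [Finset.sum_filter, Finset.sum_filter]
  -- split `[1, N]` at `h`
  rcases le_or_gt N h with hNh | hhN
  · -- everything vanishes
    have h0 : N - h = 0 := Nat.sub_eq_zero_of_le hNh
    rw [h0, Finset.Icc_eq_empty_of_lt (by norm_num : (0:ℕ) < 1), Finset.sum_empty]
    refine Finset.sum_eq_zero fun n hn => ?_
    rw [Finset.mem_Icc] at hn
    have : Int.toNat ((n : ℤ) + (-(h : ℤ))) = 0 := by omega
    rw [this]; simp
  · have hsplit : Finset.Icc 1 N = Finset.Icc 1 h ∪ Finset.Icc (h + 1) N := by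
      ext n; simp only [Finset.mem_union, Finset.mem_Icc]; omega
    have hdisj : Disjoint (Finset.Icc 1 h) (Finset.Icc (h + 1) N) := by
      rw [Finset.disjoint_left]; intro n h1 h2
      rw [Finset.mem_Icc] at h1 h2; omega
    rw [hsplit, Finset.sum_union hdisj]
    have hzero : ∑ n ∈ Finset.Icc 1 h, (if n ≡ w [MOD q] then
        (ArithmeticFunction.liouville (Int.toNat ((n : ℤ) + (-(h : ℤ)))) : ℝ) else 0) = 0 := by
      refine Finset.sum_eq_zero fun n hn => ?_
      rw [Finset.mem_Icc] at hn
      have : Int.toNat ((n : ℤ) + (-(h : ℤ))) = 0 := by omega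
      rw [this]; simp
    rw [hzero, zero_add]
    -- re-index the second part
    have hmap : Finset.Icc (h + 1) N = (Finset.Icc 1 (N - h)).map (addRightEmbedding h) := by
      rw [Finset.map_add_right_Icc]
      congr 1 <;> omega
    rw [hmap, Finset.sum_map]
    refine Finset.sum_congr rfl fun m _ => ?_
    have h1 : (addRightEmbedding h m : ℕ) = m + h := rfl
    rw [h1]
    have h2 : Int.toNat (((m + h : ℕ) : ℤ) + (-(h : ℤ))) = m := by push_cast; omega
    rw [h2]

/-- `t ↦ t/(log t)^A` is non-decreasing on `[e^A, ∞)` (elementary form). [folklore] -/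
theorem div_log_rpow_mono {A M x : ℝ} (hA : 0 < A) (hM : Real.exp A ≤ M) (hMx : M ≤ x) :
    M / Real.log M ^ A ≤ x / Real.log x ^ A := by
  have hMpos : 0 < M := (Real.exp_pos A).trans_le hM
  have hxpos : 0 < x := hMpos.trans_le hMx
  have hlogM : A ≤ Real.log M := by
    calc A = Real.log (Real.exp A) := (Real.log_exp A).symm
      _ ≤ Real.log M := Real.log_le_log (Real.exp_pos A) hM
  have hlogMpos : 0 < Real.log M := hA.trans_le hlogM
  set u := x / M with hu
  have hu1 : 1 ≤ u := by rw [hu, le_div_iff₀ hMpos, one_mul]; exact hMx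
  have hupos : 0 < u := one_pos.trans_le hu1
  have hx : x = M * u := by rw [hu]; field_simp
  have hlogx : Real.log x = Real.log M + Real.log u := by
    rw [hx, Real.log_mul hMpos.ne' hupos.ne']
  have hlogu : 0 ≤ Real.log u := Real.log_nonneg hu1
  -- `(log M + log u)^A ≤ u (log M)^A`
  have hkey : Real.log x ^ A ≤ u * Real.log M ^ A := by
    rw [hlogx]
    have hfac : Real.log M + Real.log u = Real.log M * (1 + Real.log u / Real.log M) := by
      field_simp
    rw [hfac, Real.mul_rpow hlogMpos.le (by positivity), mul_comm]
    refine mul_le_mul_of_nonneg_right ?_ (by positivity)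
    -- `(1 + log u / log M)^A ≤ exp (A * (log u / log M)) ≤ exp (log u) = u`
    have h1 : 0 < 1 + Real.log u / Real.log M := by positivity
    calc (1 + Real.log u / Real.log M) ^ A
        = Real.exp (A * Real.log (1 + Real.log u / Real.log M)) := by
          rw [Real.rpow_def_of_pos h1, mul_comm]
      _ ≤ Real.exp (A * (Real.log u / Real.log M)) := by
          refine Real.exp_le_exp.2 (mul_le_mul_of_nonneg_left ?_ hA.le)
          have := Real.log_le_sub_one_of_pos h1
          linarith
      _ ≤ Real.exp (Real.log u) := by
          refine Real.exp_le_exp.2 ?_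
          rw [mul_div_assoc']
          rw [div_le_iff₀ hlogMpos]
          calc A * Real.log u ≤ Real.log M * Real.log u :=
                mul_le_mul_of_nonneg_right hlogM hlogu
            _ = Real.log u * Real.log M := mul_comm _ _
      _ = u := Real.exp_log hupos
  have hlogxpos : 0 < Real.log x ^ A := by
    have : 0 < Real.log x := by rw [hlogx]; linarith
    positivity
  rw [div_le_div_iff₀ (by positivity) hlogxpos]
  calc M * Real.log x ^ A ≤ M * (u * Real.log M ^ A) := mul_le_mul_of_nonneg_left hkey hMpos.le
    _ = x * Real.log M ^ A := by rw [hx]; ring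

/-- The class `m + h ≡ w (mod q)` as a `ZMod q` fibre. [folklore] -/
theorem filter_add_modEq_eq (M h q w : ℕ) :
    (Finset.Icc 1 M).filter (fun m : ℕ => m + h ≡ w [MOD q]) =
      (Finset.Icc 1 M).filter (fun m : ℕ => (m : ZMod q) = (w : ZMod q) - (h : ZMod q)) := by
  refine Finset.filter_congr (fun m _ => ?_)
  rw [← ZMod.natCast_eq_natCast_iff, Nat.cast_add, eq_sub_iff_add_eq]

/-- **The fixed-dilation, unit-`(r, s)` corner of X2 is a THEOREM (in tree).** For every shift `-h`,
every FIXED dilation range `q ≤ Q₀` and every `A > 0` there are `C, x₀` with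
`∑_{q ≤ Q₀} |∑_{n ≤ y, n ≡ w (q)} λ(n - h)| ≤ C x / (log x)^A` for all `x ≥ x₀`, all classes `w` and
all `0 ≤ y ≤ x` — the `R = S = 1`, `q ≤ Q₀` slice of `TypeI2Dilated` at `c = -h` (the glue's sign;
`Int.toNat` corner included), from Siegel–Walfisz for `λ`
(`Literature.NumberTheory.LFunctions.SiegelWalfiszMoebius_holds.liouville_progression`, PROVED in
tree) and the monotonicity of `t/(log t)^A`. The same proof gives `q ≤ (log x)^B` at the cost of
`A ↦ A + B`; everything beyond — the divisor variable `s`, the outer modulus `r`, and dilations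
`q > (log x)^B` — is the open content. -/
theorem slice_fixedQ_unit (h Q₀ : ℕ) {A : ℝ} (hA : 0 < A) :
    ∃ C x₀ : ℝ, ∀ x : ℝ, x₀ ≤ x → ∀ w : ℕ, ∀ y : ℝ, 0 ≤ y → y ≤ x →
      ∑ q ∈ Finset.Icc 1 Q₀, |∑ n ∈ (Finset.Icc 1 ⌊y⌋₊).filter (fun n : ℕ => n ≡ w [MOD q]),
        (ArithmeticFunction.liouville (Int.toNat ((n : ℤ) + (-(h : ℤ)))) : ℝ)| ≤
        C * x / Real.log x ^ A := by
  obtain ⟨C₁, hC₁⟩ :=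
    Literature.NumberTheory.LFunctions.SiegelWalfiszMoebius_holds.liouville_progression one_pos A
  set C₁' := max C₁ 0 with hC₁'def
  have hC₁'0 : 0 ≤ C₁' := le_max_right _ _
  have hCC : C₁ ≤ C₁' := le_max_left _ _
  set M₀ : ℝ := max (Real.exp A) (max 2 (Real.exp Q₀)) with hM₀def
  have hM₀pos : 0 < M₀ := (Real.exp_pos A).trans_le (le_max_left _ _)
  obtain ⟨X₂, hX₂⟩ := exists_log_rpow_le A one_pos (by positivity : 0 < 1 / M₀)
  refine ⟨Q₀ * (C₁' + 1), max X₂ 3, fun x hx w y hy0 hyx => ?_⟩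
  have hX₂x : X₂ ≤ x := (le_max_left _ _).trans hx
  have h3x : (3 : ℝ) ≤ x := (le_max_right _ _).trans hx
  have hxpos : 0 < x := by linarith
  have hlogpos : 0 < Real.log x := Real.log_pos (by linarith)
  have hlogApos : 0 < Real.log x ^ A := Real.rpow_pos_of_pos hlogpos A
  -- `M₀ ≤ x / (log x)^A`
  have hM₀le : M₀ ≤ x / Real.log x ^ A := by
    have h1 : Real.log x ^ A ≤ 1 / M₀ * x ^ (1 : ℝ) := hX₂ x hX₂x
    rw [Real.rpow_one] at h1
    rw [le_div_iff₀ hlogApos]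
    calc M₀ * Real.log x ^ A ≤ M₀ * (1 / M₀ * x) := mul_le_mul_of_nonneg_left h1 hM₀pos.le
      _ = x := by field_simp
  -- per-dilation bound
  have hper : ∀ q ∈ Finset.Icc 1 Q₀,
      |∑ n ∈ (Finset.Icc 1 ⌊y⌋₊).filter (fun n : ℕ => n ≡ w [MOD q]),
        (ArithmeticFunction.liouville (Int.toNat ((n : ℤ) + (-(h : ℤ)))) : ℝ)| ≤
        C₁' * x / Real.log x ^ A + M₀ := by
    intro q hq
    rw [Finset.mem_Icc] at hq
    rw [sum_shift_neg]
    set M := ⌊y⌋₊ - h with hMdef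
    have hMx : (M : ℝ) ≤ x := by
      have h1 : ((⌊y⌋₊ - h : ℕ) : ℝ) ≤ (⌊y⌋₊ : ℝ) := by exact_mod_cast Nat.sub_le _ _
      exact h1.trans ((Nat.floor_le hy0).trans hyx)
    have hnonneg1 : 0 ≤ C₁' * x / Real.log x ^ A := by positivity
    rcases lt_or_ge (M : ℝ) M₀ with hsmall | hlarge
    · -- trivial bound `≤ M < M₀`
      have htriv := Literature.NumberTheory.Sieve.FouvryTenenbaum.abs_sum_liouville_filter_le (Nat.cast_nonneg M)
        (fun m : ℕ => m + h ≡ w [MOD q])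
      rw [Nat.floor_natCast] at htriv
      linarith
    · -- Siegel–Walfisz at height `M`
      have hM2 : (2 : ℝ) ≤ M := ((le_max_left _ _).trans (le_max_right _ _)).trans hlarge
      have hMA : Real.exp A ≤ M := (le_max_left _ _).trans hlarge
      have hMQ : Real.exp Q₀ ≤ M := ((le_max_right _ _).trans (le_max_right _ _)).trans hlarge
      have hMpos : (0 : ℝ) < M := by linarith
      have hqlog : (q : ℝ) ≤ Real.log M ^ (1 : ℝ) := by
        rw [Real.rpow_one]
        calc (q : ℝ) ≤ Q₀ := by exact_mod_cast hq.2
          _ = Real.log (Real.exp Q₀) := (Real.log_exp _).symm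
          _ ≤ Real.log M := Real.log_le_log (Real.exp_pos _) hMQ
      have hSW := hC₁ M hM2 q hq.1 hqlog ((w : ZMod q) - (h : ZMod q))
      rw [Nat.floor_natCast, ← filter_add_modEq_eq] at hSW
      have hmono := div_log_rpow_mono hA hMA hMx
      have hlogMpos : 0 < Real.log M ^ A :=
        Real.rpow_pos_of_pos (Real.log_pos (by linarith)) A
      calc |∑ m ∈ (Finset.Icc 1 M).filter (fun m : ℕ => m + h ≡ w [MOD q]),
              (ArithmeticFunction.liouville m : ℝ)|
          ≤ C₁ * M / Real.log M ^ A := hSW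
        _ ≤ C₁' * M / Real.log M ^ A :=
            div_le_div_of_nonneg_right (mul_le_mul_of_nonneg_right hCC hMpos.le) hlogMpos.le
        _ = C₁' * (M / Real.log M ^ A) := by ring
        _ ≤ C₁' * (x / Real.log x ^ A) := mul_le_mul_of_nonneg_left hmono hC₁'0
        _ = C₁' * x / Real.log x ^ A := by ring
        _ ≤ C₁' * x / Real.log x ^ A + M₀ := by linarith
  -- sum over `q ≤ Q₀`
  calc ∑ q ∈ Finset.Icc 1 Q₀, |∑ n ∈ (Finset.Icc 1 ⌊y⌋₊).filter (fun n : ℕ => n ≡ w [MOD q]),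
          (ArithmeticFunction.liouville (Int.toNat ((n : ℤ) + (-(h : ℤ)))) : ℝ)|
      ≤ ∑ q ∈ Finset.Icc 1 Q₀, (C₁' * x / Real.log x ^ A + M₀) := Finset.sum_le_sum hper
    _ = Q₀ * (C₁' * x / Real.log x ^ A + M₀) := by
        rw [Finset.sum_const, nsmul_eq_mul, Nat.card_Icc, Nat.add_sub_cancel]
    _ ≤ Q₀ * (C₁' * x / Real.log x ^ A + x / Real.log x ^ A) := by
        refine mul_le_mul_of_nonneg_left (by linarith) (Nat.cast_nonneg _)
    _ = Q₀ * (C₁' + 1) * x / Real.log x ^ A := by ring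

end Summit.Parity.GeneralizedHardyLittlewood.Cruxes.TypeI2Dilated.Negative
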